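import Literature.NumberTheory.GaloisRepresentations.HomDualPresentation
import HarnessLib

/-!
# The readout and the cup product: `δ₀(h) ∪ y = − h_*(δ₁ y)` for the evaluation pairing
# `Hom(N, A) × N → A` of the `Hom(·, A)`-dual of a presentation (native continuous cochains)

Topic `NumberTheory/GaloisRepresentations`; namespace `Literature.NumberTheory.GaloisRepresentations.HomDual`.
Definitions with bodies (`evalPairing`, `equivariantMap`) and one theorem; no named fact, no instance, no
`sorry`.  Sequel to `HomDualPresentation` (door-c6 g16: the dual sequence `0 → Hom(N, A) → Hom(P, A) →
Hom(N₁, A) → 0` of a presentation `0 → N₁ → P → N → 0`, its native connecting map `dualδ₀`).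

THE MATHEMATICS (the "(0,2) trick" of the presentation road; NSW (1.4.3)/(1.3.2) at cochain level).  For an
equivariant `h : N₁ → A` (an invariant of `Hom(N₁, A)`) and a class `y ∈ H¹(K, N)`:

  `δ₀(h) ∪ y = − h_*(δ₁ y)`  in `H²(K, A)`,

where `∪` is the cup product of the evaluation pairing `Hom(N, A) × N → A` (the tree's
`ContPairing.cupProduct`), `δ₀` the connecting map of the DUAL sequence and `δ₁ : H¹(K, N) → H²(K, N₁)` that of
the presentation (both the tree's native `IsSES.δ₀/δ₁`).  Proof on cochains: choose a lift `w : P → A` of `h`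
and a continuous lift `φ̃ : Γ → P` of a crossed homomorphism representing `y`; then
`(δ₀h ∪ y)(σ, τ) = σ·w(φ̃ τ) − w(σ φ̃ τ)` and `h(δ₁y(σ, τ)) = w(σ φ̃ τ) − w(φ̃(στ)) + w(φ̃ σ)`, whose SUM is the
coboundary of `σ ↦ w(φ̃ σ)`.  (The tensor-exactness hypotheses of Brown V (3.3) fail for finite `N`, so the
engine's `δ_cupProductRep_left` does not apply; the identity is proved directly.)

USE (hypothesis (R4) of `middleExact_allPlaces_of_readout`, Summits, door-c6 g16): the local Tate pairing of a
readout `R_v f = δ₀(h_v)` against `y_v` is `−inv_v((h_v)_* δ₁ y_v)`, a class PUSHED FORWARD FROM `H²(K_v, N₁)` —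
so the comparison with the `Ext`-side `inv_K(ŷ ∘ [S] ∘ (g f))` takes place in bidegree `(0, 2)`, with no
"cup product = Yoneda product" statement.
HONEST FRAMING: homological algebra of continuous cochains; no arithmetic statement is proved here.

## References
* J. Neukirch, A. Schmidt, K. Wingberg, *Cohomology of Number Fields* (2008), (1.3.2) (connecting maps on
  cochains), (1.4.3)–(1.4.4) (cup product and `δ`). [NeukirchSchmidtWingberg2008]
* J.-P. Serre, *Galois Cohomology* (1997), I §2.2. [SerreGaloisCohomology1997]
* J. S. Milne, *Arithmetic Duality Theorems* (2nd ed. 2006), I §0 (pairings), I Thm. 4.10 (proof). [MilneADT2006]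
-/

noncomputable section

namespace Literature.NumberTheory.GaloisRepresentations

namespace HomDual

open Literature.Algebra.Homology Literature.Algebra.Homology.DiscreteRep ContRepresentation Field

variable {K : Type} [Field K] [CompactSpace (absoluteGaloisGroup K)]
variable {X Y Z W : Type}
  [AddCommGroup X] [TopologicalSpace X] [DiscreteTopology X] [Module.Finite ℤ X]
  [AddCommGroup Y] [TopologicalSpace Y] [DiscreteTopology Y] [Module.Finite ℤ Y]
  [AddCommGroup Z] [TopologicalSpace Z] [DiscreteTopology Z] [Module.Finite ℤ Z]
  [AddCommGroup W] [TopologicalSpace W] [DiscreteTopology W]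
variable (ρX : DiscreteGaloisModule K X) (ρY : DiscreteGaloisModule K Y) (ρZ : DiscreteGaloisModule K Z)
  (ρA : DiscreteGaloisModule K W)

/-! ## §1 The evaluation pairing `Hom(Z, A) × Z → A` and equivariant maps as morphisms -/

/-- **The evaluation pairing `Hom(Z, A) × Z → A`, `(F, z) ↦ F z`**, a continuous equivariant pairing of discrete
Galois modules (`(σF)(σz) = σ(F z)`). [cite: MilneADT2006, I §0][cite: NeukirchSchmidtWingberg2008, (1.4.3)] -/
def evalPairing : ContPairing (homGaloisModule ρZ ρA).toTopRep ρZ.toTopRep ρA.toTopRep :=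
  ContPairing.ofDiscrete
    (LinearMap.mk₂ ℤ (fun (F : DiscreteRep.HomCarrier Z W) (z : Z) => (show Z →ₗ[ℤ] W from F) z)
      (fun _ _ _ => rfl) (fun _ _ _ => rfl) (fun F z z' => map_add (show Z →ₗ[ℤ] W from F) z z')
      (fun c F z => map_zsmul (show Z →ₗ[ℤ] W from F) c z))
    fun σ F z => by
      change (show Z →ₗ[ℤ] W from homGaloisModule ρZ ρA σ F) (ρZ σ z) = ρA σ ((show Z →ₗ[ℤ] W from F) z)
      rw [homGaloisModule_apply]
      change ρA σ ((show Z →ₗ[ℤ] W from F) (ρZ σ⁻¹ (ρZ σ z))) = _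
      rw [← Module.End.mul_apply, ← map_mul, inv_mul_cancel, map_one, Module.End.one_apply]

omit [CompactSpace (absoluteGaloisGroup K)] in
/-- Unfolding: `evalPairing F z = F z`. [cite: MilneADT2006, I §0] -/
@[simp] theorem evalPairing_toLin (F : DiscreteRep.HomCarrier Z W) (z : Z) :
    (evalPairing ρZ ρA).toLin F z = (show Z →ₗ[ℤ] W from F) z := rfl

/-- An invariant of `Hom(X, A)` (= an equivariant homomorphism) as a continuous equivariant map `X → A`.
[cite: MilneADT2006, I §0] -/
def equivariantMap (h : (homGaloisModule ρX ρA).toTopRep.ρ.invariants) :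
    ρX.toContRepresentation →ⁱL ρA.toContRepresentation where
  toLinearMap := (show X →ₗ[ℤ] W from (h.1 : DiscreteRep.HomCarrier X W))
  cont := continuous_of_discreteTopology
  isIntertwining' σ := by
    refine ContinuousLinearMap.ext fun x => ?_
    simpa [ContinuousRep.toContRepresentation_apply_apply] using (mem_invariants_iff ρX ρA h.1).1 h.2 σ x

omit [CompactSpace (absoluteGaloisGroup K)] in
/-- Unfolding. [cite: MilneADT2006, I §0] -/
@[simp] theorem equivariantMap_apply (h : (homGaloisModule ρX ρA).toTopRep.ρ.invariants) (x : X) :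
    equivariantMap ρX ρA h x = (show X →ₗ[ℤ] W from (h.1 : DiscreteRep.HomCarrier X W)) x := rfl

/-! ## §2 `δ₀(h) ∪ y = − h_*(δ₁ y)` -/

variable (i : ρX.toContRepresentation →ⁱL ρY.toContRepresentation)
  (p : ρY.toContRepresentation →ⁱL ρZ.toContRepresentation)

/-- **`δ₀(h) ∪ y = − h_*(δ₁ y)`** in `H²(K, A)`, for the evaluation pairing `Hom(N, A) × N → A`, the connecting
map `δ₀` of the dual sequence `0 → Hom(N, A) → Hom(P, A) → Hom(N₁, A) → 0` and the connecting map
`δ₁ : H¹(K, N) → H²(K, N₁)` of the presentation `0 → N₁ → P → N → 0`.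
[cite: NeukirchSchmidtWingberg2008, (1.4.3)–(1.4.4)][cite: SerreGaloisCohomology1997, I §2.2] -/
theorem cupProduct_dualδ₀_eq_neg (hS : IsSES (toTopRepHom ρX ρY i) (toTopRepHom ρY ρZ p)) (hW : Module.Baer ℤ W)
    (h : (homGaloisModule ρX ρA).toTopRep.ρ.invariants) (y : galoisCohomology ρZ 1) :
    (evalPairing ρZ ρA).cupProduct (dualδ₀ ρX ρY ρZ ρA i p hS hW h) y =
      - cohomologyMap (toTopRepHom ρX ρA (equivariantMap ρX ρA h)) 2 (hS.δ₁ y) := by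
  -- a crossed homomorphism `g₃` for `y` and a continuous lift `φ̃` through `p`
  obtain ⟨g₃, rfl⟩ := oneCocycleClass_surjective ρZ.toTopRep y
  let φt : C(absoluteGaloisGroup K, Y) :=
    ⟨fun σ => hS.lift (g₃.1 σ), (continuous_of_discreteTopology (f := hS.lift)).comp g₃.1.continuous⟩
  have hφt : ∀ σ, (toTopRepHom ρY ρZ p).hom (φt σ) = g₃.1 σ := fun σ => hS.g_lift (g₃.1 σ)
  have hφ : ∀ σ τ, (toTopRepHom ρY ρZ p).hom (φt (σ * τ)) =
      (toTopRepHom ρY ρZ p).hom (φt σ) + ρZ σ ((toTopRepHom ρY ρZ p).hom (φt τ)) := by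
    intro σ τ
    rw [hφt, hφt, hφt]
    exact g₃.2 σ τ
  have hy : oneCocycleClass ρZ.toTopRep g₃ = oneCocycleClass ρZ.toTopRep (IsSES.pushCocycle φt hφ) := by
    congr 1
    exact Subtype.ext (ContinuousMap.ext fun σ => (hφt σ).symm)
  -- a lift `w : Hom(P, A)` of `h`
  obtain ⟨w, hw⟩ := (isSES_dual ρX ρY ρZ ρA i p hS hW).surjective (h.1 : DiscreteRep.HomCarrier X W)
  have hw' : ∀ x : X, (show Y →ₗ[ℤ] W from w) (i x) =
      (show X →ₗ[ℤ] W from (h.1 : DiscreteRep.HomCarrier X W)) x := fun x => by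
    have := congrArg (fun F : DiscreteRep.HomCarrier X W => (show X →ₗ[ℤ] W from F) x) hw
    exact this
  rw [hy, hS.δ₁_oneCocycleClass φt hφ, dualδ₀_apply,
    (isSES_dual ρX ρY ρZ ρA i p hS hW).δ₀_apply_eq h w hw,
    ContPairing.cupProduct_oneCocycleClass_eq_twoCocycleClass, cohomologyMap_twoCocycleClass,
    eq_neg_iff_add_eq_zero, ← twoCocycleClass_add, twoCocycleClass_eq_zero_iff]
  -- the coboundary of `σ ↦ w(φ̃ σ)`
  refine ⟨⟨fun σ => (show Y →ₗ[ℤ] W from w) (φt σ),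
    (continuous_of_discreteTopology (f := fun v : Y => (show Y →ₗ[ℤ] W from w) v)).comp φt.continuous⟩,
    fun σ τ => ?_⟩
  -- evaluate the two cocycles at `(σ, τ)`
  have hker : (toTopRepHom ρY ρZ p).hom ((ρY.twoCoboundary φt).1 (σ, τ)) = 0 := by
    rw [ContinuousRep.twoCoboundary_apply, map_add, map_sub, hφ, ContinuousRep.hom_comm_apply]
    abel
  have h2 : (toTopRepHom ρX ρA (equivariantMap ρX ρA h)).hom ((hS.connectingCocycle φt hφ).1 (σ, τ)) =
      (show Y →ₗ[ℤ] W from w) (ρY σ (φt τ)) - (show Y →ₗ[ℤ] W from w) (φt (σ * τ)) +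
        (show Y →ₗ[ℤ] W from w) (φt σ) := by
    change (show X →ₗ[ℤ] W from (h.1 : DiscreteRep.HomCarrier X W)) (hS.inv ((ρY.twoCoboundary φt).1 (σ, τ))) = _
    rw [← hw', ← map_sub, ← map_add]
    congr 1
    exact hS.f_inv hker
  have h1 : (evalPairing ρZ ρA).toLin (((isSES_dual ρX ρY ρZ ρA i p hS hW).δ₀Cocycle w
        (by rw [hw]; exact h.2)).1 σ) (ρZ.toTopRep.ρ σ ((IsSES.pushCocycle φt hφ).1 τ)) =
      ρA σ ((show Y →ₗ[ℤ] W from w) (φt τ)) - (show Y →ₗ[ℤ] W from w) (ρY σ (φt τ)) := by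
    have hc := (isSES_dual ρX ρY ρZ ρA i p hS hW).f_δ₀Cocycle_apply w (by rw [hw]; exact h.2) σ
    -- `(precomp p (c σ)) = σ•w − w`; evaluate at `ρY σ (φ̃ τ)`
    have hcx := congrArg (fun F : DiscreteRep.HomCarrier Y W => (show Y →ₗ[ℤ] W from F) (ρY σ (φt τ))) hc
    simp only at hcx
    rw [IsSES.pushCocycle_apply, evalPairing_toLin]
    change (show Z →ₗ[ℤ] W from _) (ρZ σ (p.toContinuousLinearMap (φt τ))) = _
    have hpz : ρZ σ (p.toContinuousLinearMap (φt τ)) = p.toContinuousLinearMap (ρY σ (φt τ)) := by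
      simpa [ContinuousRep.toContRepresentation_apply_apply] using (congr($(p.isIntertwining' σ) (φt τ))).symm
    rw [hpz]
    refine hcx.trans ?_
    change (show Y →ₗ[ℤ] W from (homGaloisModule ρY ρA σ w - w : DiscreteRep.HomCarrier Y W)) (ρY σ (φt τ)) = _
    change (show Y →ₗ[ℤ] W from homGaloisModule ρY ρA σ w) (ρY σ (φt τ)) -
      (show Y →ₗ[ℤ] W from w) (ρY σ (φt τ)) = _
    rw [homGaloisModule_apply]
    change ρA σ ((show Y →ₗ[ℤ] W from w) (ρY σ⁻¹ (ρY σ (φt τ)))) - _ = _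
    rw [← Module.End.mul_apply, ← map_mul, inv_mul_cancel, map_one, Module.End.one_apply]
  change (ContPairing.cupCocycle (evalPairing ρZ ρA) _ _).1 (σ, τ) +
    (contTwoCocycles.pullback _ _ (hS.connectingCocycle φt hφ)).1 (σ, τ) = _
  rw [ContPairing.cupCocycle_apply_eq_smul, contTwoCocycles.pullback_apply, h1]
  change _ + (toTopRepHom ρX ρA (equivariantMap ρX ρA h)).hom ((hS.connectingCocycle φt hφ).1 (σ, τ)) = _
  rw [h2]
  change _ = ρA σ ((show Y →ₗ[ℤ] W from w) (φt τ)) - (show Y →ₗ[ℤ] W from w) (φt (σ * τ)) +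
    (show Y →ₗ[ℤ] W from w) (φt σ)
  abel

end HomDual

end Literature.NumberTheory.GaloisRepresentations

end
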